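import Literature.AlgebraicGeometry.Resolution.KummerChartLogRegular
import Literature.AlgebraicGeometry.Resolution.KummerRootCoverRegular
import Literature.AlgebraicGeometry.Resolution.DivisorialMonoidPrimes
import Literature.AlgebraicGeometry.Resolution.RegularLocalRingsQuotient
import Mathlib.Algebra.Group.Submonoid.Finsupp
import HarnessLib

/-!
# The roots of the Kummer root cover are prime; divisors of monomials are unit monomials

Topic: `Literature/AlgebraicGeometry/Resolution`. In the root cover `B' = O[s]/(s_j^p - x_j)` of
a regular local ring `O` at boundary equations `x_j ∈ 𝔪` independent modulo `𝔪²`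
(`KummerRootCover*.lean`; `B'` is regular local with maximal ideal `𝔐 = 𝔪B' + (s)`):

* `RootCover.coord_mem_of_mem_map` — elements of `𝔪B'` have all coordinates in `𝔪`;
* `RootCover.coord_single_rootMonomial_mem` — the `e_j`-coordinate of `s^k b` lies in `𝔪`
  as soon as `|k| ≥ 2`; hence `RootCover.root_notMem_sq` — `s_j ∉ 𝔐²` — and
  `RootCover.root_prime` — each `s_j` is a PRIME element of the regular local ring `B'`
  (Matsumura 14.2–14.3);
* `RootCover.exists_unit_mul_rootMonomial_of_dvd` — an element of `B'` dividing a power of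
  `∏ x_j = ∏ s_j^p` is a unit times a monomial `s^k` (Euclid in `B'`,
  `DivisorialMonoidPrimes.lean`) — Kato's Thm. 11.6 for the free chart of the regular cover.

This is the input for the divisorial description of the log structure of the toric algebra
(`KummerToricDivisorial.lean`). Sources: [Kato1994] K. Kato, *Toric singularities*, Amer. J.
Math. 116 (1994), Thm. 11.6; [Matsumura1987] Thm. 14.2–14.3. All statements PROVED.
-/

noncomputable section

namespace Literature.AlgebraicGeometry.Resolution

open MvPolynomial IsLocalRing

namespace RootCover

variable {O : Type*} [CommRing O] {r : ℕ} {p : ℕ} [hp : Fact p.Prime] {x : Fin r → O}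

/-! ## Coordinates of products -/

/-- Coordinates of `b · s^k`: `coord (b s^k) = ∑_m coord_m(b) · x^{(m+k)/p} e_{(m+k) mod p}`.
[folklore] -/
theorem coord_mul_rootMonomial (b : RootCover p x) (k : Fin r → ℕ) (n : Fin r → Fin p) :
    coord (b * rootMonomial p x k) n =
      ∑ m : Fin r → Fin p, if modBox' (p := p) (fun j => (m j : ℕ) + k j) = n then
        coord b m * ∏ j, x j ^ (((m j : ℕ) + k j) / p) else 0 := by
  conv_lhs => rw [← sum_coord_smul_boxMonomial b, Finset.sum_mul, map_sum, Finset.sum_apply]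
  refine Finset.sum_congr rfl fun m _ => ?_
  rw [smul_mul_assoc, map_smul, Pi.smul_apply, ← rootMonomial_val, ← rootMonomial_add,
    coord_rootMonomial, Pi.smul_apply, Pi.single_apply, smul_eq_mul, smul_eq_mul]
  simp only [mul_ite, mul_one, mul_zero]
  have : (modBox' (p := p) ((fun j => (m j : ℕ)) + k)) = modBox' (fun j => (m j : ℕ) + k j) := rfl
  rw [this]
  by_cases h : modBox' (p := p) (fun j => (m j : ℕ) + k j) = n
  · rw [if_pos h, if_pos h.symm]
    rfl
  · rw [if_neg h, if_neg (Ne.symm h)]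

section Local

variable [IsLocalRing O]

/-- **Elements of `𝔪B'` have all their coordinates in `𝔪`.** [folklore] -/
theorem coord_mem_of_mem_map {b : RootCover p x}
    (hb : b ∈ (maximalIdeal O).map (algebraMap O (RootCover p x))) (n : Fin r → Fin p) :
    coord b n ∈ maximalIdeal O := by
  rw [Ideal.map] at hb
  refine Submodule.span_induction (p := fun b _ => ∀ n, coord b n ∈ maximalIdeal O)
    ?_ ?_ ?_ ?_ hb n
  · rintro _ ⟨a, ha, rfl⟩ n
    rw [Algebra.algebraMap_eq_smul_one, map_smul, Pi.smul_apply, smul_eq_mul]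
    exact Ideal.mul_mem_right _ _ ha
  · intro n; simp
  · intro a b _ _ ha hb n
    rw [map_add, Pi.add_apply]
    exact Ideal.add_mem _ (ha n) (hb n)
  · intro a b _ hb n
    rw [smul_eq_mul, mul_comm, ← sum_coord_smul_boxMonomial b, Finset.sum_mul, map_sum,
      Finset.sum_apply]
    refine Ideal.sum_mem _ fun m _ => ?_
    rw [smul_mul_assoc, map_smul, Pi.smul_apply, smul_eq_mul]
    exact Ideal.mul_mem_right _ _ (hb m)

/-- **The `e_j`-coordinate of `b · s^k` lies in `𝔪` when `|k| ≥ 2`** (every box exponent `m`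
with `m + k ≡ e_j` produces a non-trivial carry, the `x_i` lying in `𝔪`). [folklore] -/
theorem coord_single_mul_rootMonomial_mem (hx : ∀ j, x j ∈ maximalIdeal O) (b : RootCover p x)
    (k : Fin r → ℕ) (hk : 2 ≤ ∑ j, k j) (j : Fin r) :
    coord (b * rootMonomial p x k) (Pi.single j ⟨1, hp.out.one_lt⟩) ∈ maximalIdeal O := by
  rw [coord_mul_rootMonomial]
  refine Ideal.sum_mem _ fun m _ => ?_
  split_ifs with hmod
  · refine Ideal.mul_mem_left _ _ ?_
    -- some carry is non-trivial
    by_contra hcarry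
    have hall : ∀ i, ((m i : ℕ) + k i) / p = 0 := by
      intro i
      by_contra hi
      apply hcarry
      rw [← Finset.mul_prod_erase _ _ (Finset.mem_univ i)]
      exact Ideal.mul_mem_right _ _ (Ideal.pow_mem_of_mem _ (hx i) _ (Nat.pos_of_ne_zero hi))
    -- then `m + k = e_j` on the nose, contradicting `|k| ≥ 2`
    have heq : ∀ i, (m i : ℕ) + k i = ((Pi.single (M := fun _ => Fin p) j ⟨1, hp.out.one_lt⟩ i : Fin p) : ℕ) := by
      intro i
      have h1 := congrArg Fin.val (congrFun hmod i)
      simp only [modBox'] at h1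
      have h2 : ((m i : ℕ) + k i) % p = (m i : ℕ) + k i := by
        have := Nat.div_add_mod ((m i : ℕ) + k i) p
        rw [hall i, mul_zero, zero_add] at this
        exact this
      rw [← h2]
      exact h1
    have hsum : ∑ i, k i ≤ 1 := by
      calc ∑ i, k i ≤ ∑ i, ((m i : ℕ) + k i) := Finset.sum_le_sum fun i _ => Nat.le_add_left _ _
        _ = ∑ i, ((Pi.single (M := fun _ => Fin p) j ⟨1, hp.out.one_lt⟩ i : Fin p) : ℕ) :=
            Finset.sum_congr rfl fun i _ => heq i
        _ = 1 := by
            rw [Finset.sum_eq_single j (fun i _ hij => by rw [Pi.single_eq_of_ne hij]; rfl)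
              (fun h => absurd (Finset.mem_univ j) h), Pi.single_eq_same]
    omega
  · exact Ideal.zero_mem _

/-- **`s_j ∉ 𝔐²`** in the root cover of a local ring at elements of `𝔪` (`𝔐 = 𝔪B' + (s)`): the
`e_j`-coordinate of every element of `𝔐² ⊆ 𝔪B' + (s_k s_l)` lies in `𝔪`, while that of
`s_j` is `1`. [cite: Matsumura1987, Thm. 14.2] -/
theorem root_notMem_sq (hx : ∀ j, x j ∈ maximalIdeal O) (j : Fin r) :
    root p x j ∉ maxIdeal p x ^ 2 := by
  classical
  set ej : Fin r → Fin p := Pi.single j ⟨1, hp.out.one_lt⟩ with hej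
  -- the functional `b ↦ coord_{e_j}(b)` sends `𝔐²` into `𝔪`
  have key : ∀ y ∈ maxIdeal p x ^ 2, ∀ b : RootCover p x, coord (b * y) ej ∈ maximalIdeal O := by
    intro y hy
    rw [pow_two, maxIdeal, Ideal.map, ← Ideal.span_union, Ideal.span_mul_span'] at hy
    refine Submodule.span_induction (p := fun y _ => ∀ b : RootCover p x, coord (b * y) ej ∈ maximalIdeal O)
      ?_ ?_ ?_ ?_ hy
    · rintro _ ⟨g, hg, g', hg', rfl⟩ b
      change coord (b * (g * g')) ej ∈ maximalIdeal O
      rcases hg with ⟨a, ha, rfl⟩ | ⟨k, rfl⟩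
      · -- a factor from `𝔪`: the product lies in `𝔪B'`
        refine coord_mem_of_mem_map ?_ ej
        rw [← mul_assoc, mul_comm b, mul_assoc]
        exact Ideal.mul_mem_right _ _ (Ideal.mem_map_of_mem _ ha)
      · rcases hg' with ⟨a, ha, rfl⟩ | ⟨l, rfl⟩
        · refine coord_mem_of_mem_map ?_ ej
          rw [← mul_assoc]
          exact Ideal.mul_mem_left _ _ (Ideal.mem_map_of_mem _ ha)
        · -- `b · s_k s_l`
          have : root p x k * root p x l = rootMonomial p x (Pi.single k 1 + Pi.single l 1) := by
            rw [rootMonomial_add, rootMonomial, rootMonomial,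
              Finset.prod_eq_single k (fun i _ hik => by rw [Pi.single_eq_of_ne hik, pow_zero])
                (fun h => absurd (Finset.mem_univ k) h),
              Finset.prod_eq_single l (fun i _ hil => by rw [Pi.single_eq_of_ne hil, pow_zero])
                (fun h => absurd (Finset.mem_univ l) h)]
            simp
          rw [this]
          refine coord_single_mul_rootMonomial_mem hx b _ ?_ j
          simp only [Pi.add_apply]
          rw [Finset.sum_add_distrib, Finset.sum_pi_single', Finset.sum_pi_single']
          simp
    · intro b; simp
    · intro y z _ _ hy hz b
      rw [mul_add, map_add, Pi.add_apply]
      exact Ideal.add_mem _ (hy b) (hz b)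
    · intro a y _ hy b
      rw [smul_eq_mul, ← mul_assoc]
      exact hy (b * a)
  intro hmem
  have h1 := key _ hmem 1
  rw [one_mul] at h1
  have h2 : coord (root p x j) ej = 1 := by
    have : root p x j = boxMonomial p x ej := by
      rw [boxMonomial, Finset.prod_eq_single j (fun i _ hij => by
        rw [hej, Pi.single_eq_of_ne hij]; rfl) (fun h => absurd (Finset.mem_univ j) h)]
      simp [hej]
    rw [this, coord_boxMonomial, Pi.single_eq_same]
  rw [h2] at h1
  exact (maximalIdeal.isMaximal O).ne_top (Ideal.eq_top_of_isUnit_mem _ h1 isUnit_one)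

end Local

section Regular

variable [IsRegularLocalRing O]

/-- **Each root `s_j` is a prime element of the root cover** of a regular local ring at regular
parameters (an element of `𝔐 ∖ 𝔐²` of the regular local ring `B'`).
[cite: Matsumura1987, Thm. 14.3] -/
theorem root_prime (hx : ∀ j, x j ∈ maximalIdeal O)
    (hli : ∀ α : Fin r → O, ∑ i, α i * x i ∈ maximalIdeal O ^ 2 → ∀ i, α i ∈ maximalIdeal O)
    (j : Fin r) : Prime (root p x j) := by
  obtain ⟨hreg, -⟩ := isRegularLocalRing (p := p) hx hli
  haveI := hreg
  obtain ⟨_, hmax⟩ := isLocalRing (p := p) hx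
  refine IsRegularLocalRing.prime_of_not_mem_sq ?_ ?_
  · rw [hmax]
    exact Ideal.mem_sup_right (Ideal.subset_span ⟨j, rfl⟩)
  · rw [hmax]
    exact root_notMem_sq hx j

/-- **Divisors of monomials in the root cover are unit monomials** (Kato 11.6 for the free
chart of the regular cover): if `b ∣ (∏ x_j)^N` in `B'` then `b = u · s^k` with `u` a unit.
[cite: Kato1994, Thm. 11.6] -/
theorem exists_unit_mul_rootMonomial_of_dvd (hx : ∀ j, x j ∈ maximalIdeal O)
    (hli : ∀ α : Fin r → O, ∑ i, α i * x i ∈ maximalIdeal O ^ 2 → ∀ i, α i ∈ maximalIdeal O)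
    {b : RootCover p x} {N : ℕ}
    (hb : b ∣ algebraMap O (RootCover p x) (∏ j, x j) ^ N) :
    ∃ (u : RootCover p x) (k : Fin r → ℕ), IsUnit u ∧ b = u * rootMonomial p x k := by
  obtain ⟨hreg, -⟩ := isRegularLocalRing (p := p) hx hli
  haveI := hreg
  haveI := isDomain_of_isRegularLocalRing (RootCover p x)
  have hprod : algebraMap O (RootCover p x) (∏ j, x j) = (∏ j, root p x j) ^ p := by
    rw [map_prod, ← Finset.prod_pow]
    exact Finset.prod_congr rfl fun j _ => (root_pow j).symm
  rw [hprod, ← pow_mul] at hb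
  have hmem : b ∈ divisorialMonoid (Ideal.span {∏ j, root p x j}) :=
    mem_divisorialMonoid_span_singleton_iff.mpr ⟨_, hb⟩
  rw [divisorialMonoid_span_prod_eq_sup_closure _ (fun j => Or.inl (root_prime hx hli j))] at hmem
  obtain ⟨u, hu, m, hm, rfl⟩ := Submonoid.mem_sup.mp hmem
  obtain ⟨k, rfl⟩ := Submonoid.exists_of_mem_closure_range _ _ hm
  exact ⟨u, k, hu, rfl⟩

end Regular

end RootCover

end Literature.AlgebraicGeometry.Resolution

end
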